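import Mathlib
import Summits.NavierStokesRegularity.NavierStokesRegularity.Theorems.FilamentSkeletonRssStadiumChordModulus

/-!
# Route `FilamentSkeletonRss` · child crux `TangentSkeletonNearStraightL` (stmt-NavierStokesRegularity-23320) · registered line
# `child_tangent_analytic_strip_L` (b0b56c52900dd90a), stub `stub_stripPropagation` — brick: THE CHORD MODULUS FOR AN AFFINE RADIUS, CLOSED FORMS

Toward item R1 (CornerRight with numbers) of the quarter-width blueprint (evidence `CORNER-QUARTER-BLUEPRINT-leafhand-15-g0.md` v4 on 23320).
Along a descent chord of the corner contour the admissible Cauchy radius is AFFINE in the chord parameter, `d(r) = d₀ + d₁ r`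
(distance to the stadium end and height both vary linearly), so the Lipschitz modulus of `Theorems.StadiumChordModulus` is an explicit
logarithm and the two integrals entering `Theorems.StadiumHybridChord.hybrid_chord_re_ge` (`∫_θ¹ G`, `∫_θ¹ G²`) are elementary:
* `integral_const_div_affine` — `∫₀ʳ c/(d₀ + d₁t) dt = (c/d₁)(log(d₀ + d₁r) − log d₀)`;
* `chord_modulus_affine_le` — `‖F′(z+rs) − F′(z+r′s)‖ ≤ |G r − G r′|` with `G r = (‖s‖M/d₁)(log(d₀ + d₁ r) − log d₀)`;
* `integral_log_affine`, `integral_log_sq_affine` — `∫_θ¹ log(d₀+d₁r)` and `∫_θ¹ log²(d₀+d₁r)` in closed form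
  (antiderivatives `(u log u − u)/d₁`, `(u log²u − 2u log u + 2u)/d₁`, `u = d₀ + d₁ r`).
HONEST FRAMING: elementary calculus for a plan about a HYPOTHETICAL filament skeleton on the NEGATIVE side of a MODEL route; the stub
`stub_stripPropagation` is NOT closed by this file; nothing here bears on Navier–Stokes regularity or blow-up.  `--supports stmt-NavierStokesRegularity-23320`.
-/

set_option linter.dupNamespace false

noncomputable section

namespace Summit.NavierStokesRegularity.NavierStokesRegularity.Theorems.StadiumChordModulusAffine

open Set Metric MeasureTheory
open Summit.NavierStokesRegularity.NavierStokesRegularity.Theorems.StadiumChordModulus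

/-- `∫₀ʳ c/(d₀ + d₁ t) dt = (c/d₁)·(log(d₀ + d₁ r) − log d₀)` when `d₁ ≠ 0` and `d₀ + d₁ t > 0` on `[0, r]` (`0 ≤ r`). [folklore] -/
theorem integral_const_div_affine {c d₀ d₁ r : ℝ} (hd₁ : d₁ ≠ 0) (hr : 0 ≤ r)
    (hpos : ∀ t ∈ Icc (0:ℝ) r, 0 < d₀ + d₁ * t) :
    ∫ t in (0:ℝ)..r, c / (d₀ + d₁ * t) = c / d₁ * (Real.log (d₀ + d₁ * r) - Real.log d₀) := by
  have hIcc : uIcc (0:ℝ) r = Icc 0 r := uIcc_of_le hr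
  have hder : ∀ t ∈ uIcc (0:ℝ) r, HasDerivAt (fun t : ℝ => c / d₁ * Real.log (d₀ + d₁ * t)) (c / (d₀ + d₁ * t)) t := by
    intro t ht
    rw [hIcc] at ht
    have hp := hpos t ht
    have h1 : HasDerivAt (fun t : ℝ => d₀ + d₁ * t) d₁ t := by
      have h := ((hasDerivAt_id t).const_mul d₁).const_add d₀
      simpa using h
    have h2 := (h1.log hp.ne').const_mul (c / d₁)
    refine h2.congr_deriv ?_
    field_simp
  have hcont : ContinuousOn (fun t : ℝ => c / (d₀ + d₁ * t)) (uIcc (0:ℝ) r) := by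
    rw [hIcc]
    exact continuousOn_const.div (continuousOn_const.add (continuousOn_const.mul continuousOn_id)) fun t ht => (hpos t ht).ne'
  rw [intervalIntegral.integral_eq_sub_of_hasDerivAt hder hcont.intervalIntegrable]
  simp only [mul_zero, add_zero]
  ring

/-- **Chord modulus for an affine radius.**  `F : ℂ → ℂ³` holomorphic on an open `U` with `‖F′‖ ≤ M`; a chord `z + [0,1]·s`; an affine radius
`d(r) = d₀ + d₁ r` (`d₁ ≠ 0`, positive on `[0,1]`) with `closedBall (z + r s) (d r) ⊆ U` on `[0,1]`.  Then for `r, r′ ∈ [0,1]`: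
`‖F′(z+rs) − F′(z+r′s)‖ ≤ |G r − G r′|`, `G r = (‖s‖M/d₁)(log(d₀ + d₁r) − log d₀)`. [folklore] -/
theorem chord_modulus_affine_le {U : Set ℂ} (hU : IsOpen U) {F : ℂ → (Fin 3 → ℂ)} (hF : DifferentiableOn ℂ F U)
    {M : ℝ} (hM : ∀ w ∈ U, ‖deriv F w‖ ≤ M) {z s : ℂ} {d₀ d₁ : ℝ} (hd₁ : d₁ ≠ 0) (hd0 : 0 < d₀) (hd1 : 0 < d₀ + d₁)
    (hball : ∀ r ∈ Icc (0:ℝ) 1, closedBall (z + (r : ℂ) * s) (d₀ + d₁ * r) ⊆ U) {r r' : ℝ}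
    (hr : r ∈ Icc (0:ℝ) 1) (hr' : r' ∈ Icc (0:ℝ) 1) :
    ‖deriv F (z + (r : ℂ) * s) - deriv F (z + (r' : ℂ) * s)‖ ≤
      |‖s‖ * M / d₁ * (Real.log (d₀ + d₁ * r) - Real.log d₀) - ‖s‖ * M / d₁ * (Real.log (d₀ + d₁ * r') - Real.log d₀)| := by
  -- a globally positive continuous radius profile agreeing with the affine one on `[0,1]`: clamp the parameter
  set dcl : ℝ → ℝ := fun t => d₀ + d₁ * max 0 (min t 1) with hdcl
  have hclamp_mem : ∀ t : ℝ, max 0 (min t 1) ∈ Icc (0:ℝ) 1 := fun t =>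
    ⟨le_max_left _ _, max_le zero_le_one (min_le_right _ _)⟩
  have hclamp_eq : ∀ t ∈ Icc (0:ℝ) 1, max 0 (min t 1) = t := fun t ht => by
    rw [min_eq_left ht.2, max_eq_right ht.1]
  have haff_pos : ∀ t ∈ Icc (0:ℝ) 1, 0 < d₀ + d₁ * t := by
    intro t ht
    rcases le_or_gt 0 d₁ with h | h
    · nlinarith [ht.1]
    · nlinarith [ht.2]
  have hdc : Continuous dcl := continuous_const.add (continuous_const.mul (continuous_const.max (continuous_id.min continuous_const)))
  have hdpos : ∀ t, 0 < dcl t := fun t => haff_pos _ (hclamp_mem t)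
  have hball' : ∀ t ∈ Icc (0:ℝ) 1, closedBall (z + (t : ℂ) * s) (dcl t) ⊆ U := by
    intro t ht; simp only [hdcl, hclamp_eq t ht]; exact hball t ht
  have h := chord_modulus_le hU hF hM hdc hdpos hball' hr hr'
  -- the integrals of the clamped profile are the affine closed forms on `[0,1]`
  have hI : ∀ ρ ∈ Icc (0:ℝ) 1, ∫ t in (0:ℝ)..ρ, ‖s‖ * M / dcl t =
      ‖s‖ * M / d₁ * (Real.log (d₀ + d₁ * ρ) - Real.log d₀) := by
    intro ρ hρ
    have e : ∫ t in (0:ℝ)..ρ, ‖s‖ * M / dcl t = ∫ t in (0:ℝ)..ρ, ‖s‖ * M / (d₀ + d₁ * t) := by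
      refine intervalIntegral.integral_congr fun t ht => ?_
      rw [uIcc_of_le hρ.1] at ht
      have ht' : t ∈ Icc (0:ℝ) 1 := ⟨ht.1, ht.2.trans hρ.2⟩
      simp only [hdcl, hclamp_eq t ht']
    rw [e]
    exact integral_const_div_affine hd₁ hρ.1 fun t ht => haff_pos t ⟨ht.1, ht.2.trans hρ.2⟩
  rw [hI r hr, hI r' hr'] at h
  exact h

/-- `∫_θ¹ log(d₀ + d₁ r) dr` in closed form (`d₁ ≠ 0`, `d₀ + d₁ r > 0` on `[θ,1]`, `θ ≤ 1`). [folklore] -/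
theorem integral_log_affine {d₀ d₁ θ : ℝ} (hd₁ : d₁ ≠ 0) (hθ : θ ≤ 1) (hpos : ∀ r ∈ Icc θ 1, 0 < d₀ + d₁ * r) :
    ∫ r in θ..1, Real.log (d₀ + d₁ * r) =
      ((d₀ + d₁ * 1) * Real.log (d₀ + d₁ * 1) - (d₀ + d₁ * 1)) / d₁ - ((d₀ + d₁ * θ) * Real.log (d₀ + d₁ * θ) - (d₀ + d₁ * θ)) / d₁ := by
  have hIcc : uIcc θ 1 = Icc θ 1 := uIcc_of_le hθ
  have hder : ∀ r ∈ uIcc θ 1, HasDerivAt (fun r : ℝ => ((d₀ + d₁ * r) * Real.log (d₀ + d₁ * r) - (d₀ + d₁ * r)) / d₁)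
      (Real.log (d₀ + d₁ * r)) r := by
    intro r hr
    rw [hIcc] at hr
    have hp := hpos r hr
    have h1 : HasDerivAt (fun r : ℝ => d₀ + d₁ * r) d₁ r := by
      have h := ((hasDerivAt_id r).const_mul d₁).const_add d₀
      simpa using h
    have h2 := h1.log hp.ne'
    have h3 := ((h1.mul h2).sub h1).div_const d₁
    refine h3.congr_deriv ?_
    field_simp
    ring
  have hcont : ContinuousOn (fun r : ℝ => Real.log (d₀ + d₁ * r)) (uIcc θ 1) := by
    rw [hIcc]
    exact ContinuousOn.log (continuousOn_const.add (continuousOn_const.mul continuousOn_id)) fun r hr => (hpos r hr).ne'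
  rw [intervalIntegral.integral_eq_sub_of_hasDerivAt hder hcont.intervalIntegrable]

/-- `∫_θ¹ log²(d₀ + d₁ r) dr` in closed form (`d₁ ≠ 0`, `d₀ + d₁ r > 0` on `[θ,1]`, `θ ≤ 1`). [folklore] -/
theorem integral_log_sq_affine {d₀ d₁ θ : ℝ} (hd₁ : d₁ ≠ 0) (hθ : θ ≤ 1) (hpos : ∀ r ∈ Icc θ 1, 0 < d₀ + d₁ * r) :
    ∫ r in θ..1, Real.log (d₀ + d₁ * r) ^ 2 =
      ((d₀ + d₁ * 1) * Real.log (d₀ + d₁ * 1) ^ 2 - 2 * (d₀ + d₁ * 1) * Real.log (d₀ + d₁ * 1) + 2 * (d₀ + d₁ * 1)) / d₁ -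
      ((d₀ + d₁ * θ) * Real.log (d₀ + d₁ * θ) ^ 2 - 2 * (d₀ + d₁ * θ) * Real.log (d₀ + d₁ * θ) + 2 * (d₀ + d₁ * θ)) / d₁ := by
  have hIcc : uIcc θ 1 = Icc θ 1 := uIcc_of_le hθ
  have hder : ∀ r ∈ uIcc θ 1, HasDerivAt
      (fun r : ℝ => ((d₀ + d₁ * r) * Real.log (d₀ + d₁ * r) ^ 2 - 2 * (d₀ + d₁ * r) * Real.log (d₀ + d₁ * r) + 2 * (d₀ + d₁ * r)) / d₁)
      (Real.log (d₀ + d₁ * r) ^ 2) r := by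
    intro r hr
    rw [hIcc] at hr
    have hp := hpos r hr
    have h1 : HasDerivAt (fun r : ℝ => d₀ + d₁ * r) d₁ r := by
      have h := ((hasDerivAt_id r).const_mul d₁).const_add d₀
      simpa using h
    have h2 := h1.log hp.ne'
    have h2' : HasDerivAt (fun y : ℝ => Real.log (d₀ + d₁ * y) ^ 2)
        ((2 : ℕ) * Real.log (d₀ + d₁ * r) ^ (2 - 1) * (d₁ / (d₀ + d₁ * r))) r := h2.pow 2
    have h3 := (((h1.mul h2').sub ((h1.const_mul 2).mul h2)).add (h1.const_mul 2)).div_const d₁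
    convert h3 using 1
    all_goals first | rfl | (push_cast; field_simp; ring)
  have hcont : ContinuousOn (fun r : ℝ => Real.log (d₀ + d₁ * r) ^ 2) (uIcc θ 1) := by
    rw [hIcc]
    exact (ContinuousOn.log (continuousOn_const.add (continuousOn_const.mul continuousOn_id)) fun r hr => (hpos r hr).ne').pow 2
  rw [intervalIntegral.integral_eq_sub_of_hasDerivAt hder hcont.intervalIntegrable]

end Summit.NavierStokesRegularity.NavierStokesRegularity.Theorems.StadiumChordModulusAffine

end
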